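import Summits.PneNP.PneNP.Theses.KarlinRubin
import Summits.PneNP.PneNP.Theorems.KarlinRubinMonotoneSufficesTransportBridge
import Summits.PneNP.PneNP.Theorems.KarlinRubinMonotoneSufficesStubTransport
import Summits.PneNP.PneNP.Theorems.KarlinRubinMonotoneSufficesBlockPinningCount
import Literature.Computability.Complexity.PseudoComplementCircuits
import Literature.Computability.Complexity.RossmanMonotoneCliqueThm2Proofs

/-!
# Crux `MonotoneSuffices` (stmt-PneNP-18026), line `Sketch` — BLOCK PINNING, part 2: the rung

**Block pinning.** Let a detector family be `f n (x) = D n (x, a n x)` where `D n` is a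
`{∧₂,∨₂,0,1}`-circuit on the edge slots plus extra wires `κ n`, and the wire values `a n x` are
ARBITRARY Boolean functions (negations, parities, anything) whose input cone lies in a block `F n` of
edge slots (`a n x = a n x'` whenever `x, x'` agree on `F n`). If the block is CLIQUE-SPARSE,
`#(F n) · k(n)² / n² → 0` (so the planted clique has an edge in the block with probability `→ 0`), then
FIXING the block — `x_F := w⋆`, wires `:= a n w⋆` — gives `{∧₂,∨₂,0,1}`-circuits of size `≤ s n + 2`
whose error sum still tends to `0` (`blockPinning`, registered helper sub-goal).

Proof: under `G(n,1/2)` and under every planted law whose clique misses the block, the block is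
uniform noise independent of the rest, so a uniformly random pinning reproduces both error
probabilities EXACTLY (part 1: the merge involution); cliques meeting the block have probability
`≤ #F · C(n-2,m-2)/C(n,m) = #F · m(m-1)/(n(n-1))` (`card_meet_div_le`, union bound); some pinning is
below the average (`pinning_step`); hard-wiring inputs and wires to constants costs the two constant
gates (`exists_pin_circuit`).

Scope (evidence memo `session4-shift-levers.md` §2b): this makes rung 1 (negated inputs, previously
`×2^{|T|}`) and rung 1.5 (junta negations, previously `2^{|S|}`) of the negation ladder FREE for cones
up to `o(n^{1+2δ})` edge slots, and disposes of any coin supported on such a block (recursive majority,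
parity, …); it is vacuous for negations reading `Ω(n^{1+2δ})` slots (edge-count thresholds — the shift
rung — and the global recursive majority — the shift no-go `recMaj_shiftResistant`).
-/

set_option linter.dupNamespace false -- `Summit.PneNP.PneNP.…`: summit = sub-problem name (D-0017 single-conjunct layout)

namespace Summit.PneNP.PneNP.Theorems.MonotoneSuffices.BlockPinning

open Finset Filter Literature.Computability.Complexity Literature.Probability.RandomGraphs.PlantedClique
open Summit.PneNP.PneNP.Theorems.MonotoneSuffices.SliceTransport
open scoped ENNReal

/-! ### Cliques meeting the block -/

/-- **The planted sets meeting a block `F` of edge slots are few**: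
`#{A ∈ kSubsets : K_A ∩ F ≠ ∅} / #kSubsets ≤ #F · m² / (n(n-1))`, `m = min k n` (union bound over the
slots of `F`; each slot lies inside `A` with probability `m(m-1)/(n(n-1))`). [folklore] -/
theorem card_meet_div_le (n k : ℕ) (F : Finset ((⊤ : SimpleGraph (Fin n)).edgeSet)) :
    (#((kSubsets n k).filter fun A => ∃ e ∈ F, ∀ v ∈ (e : Sym2 (Fin n)), v ∈ A) : ℝ) / #(kSubsets n k) ≤
      (#F : ℝ) * ((min k n : ℕ) : ℝ) ^ 2 / ((n : ℝ) * ((n : ℝ) - 1)) := by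
  classical
  set m := min k n with hm
  have h𝒜pos : (0 : ℝ) < #(kSubsets n k) := by exact_mod_cast card_pos.2 (kSubsets_nonempty n k)
  have h𝒜 : #(kSubsets n k) = n.choose m := by rw [kSubsets, card_powersetCard, card_univ, Fintype.card_fin]
  rcases lt_or_ge m 2 with hm2 | hm2
  · -- `A` has fewer than two vertices: no slot lies inside `A`
    have hempty : ((kSubsets n k).filter fun A => ∃ e ∈ F, ∀ v ∈ (e : Sym2 (Fin n)), v ∈ A) = ∅ := by
      refine filter_eq_empty_iff.2 fun A hA ⟨e, _, he⟩ => ?_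
      have hAcard : #A = m := card_of_mem_kSubsets hA
      obtain ⟨⟨u, v⟩, huv⟩ := Quot.exists_rep (e : Sym2 (Fin n))
      have hadj : (⊤ : SimpleGraph (Fin n)).Adj u v := by
        rw [← SimpleGraph.mem_edgeSet, show s(u, v) = (e : Sym2 (Fin n)) from huv]; exact e.2
      have hne : u ≠ v := hadj.ne
      have hu : u ∈ A := he u (by rw [← huv]; exact Sym2.mem_mk_left u v)
      have hv : v ∈ A := he v (by rw [← huv]; exact Sym2.mem_mk_right u v)
      have : 2 ≤ #A := by
        rw [← card_pair hne]
        exact card_le_card (by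
          intro w hw; simp only [mem_insert, mem_singleton] at hw; rcases hw with rfl | rfl <;> assumption)
      omega
    rw [hempty, card_empty, Nat.cast_zero, zero_div]
    have hnn : (0 : ℝ) ≤ (n : ℝ) * ((n : ℝ) - 1) := by
      rcases Nat.eq_zero_or_pos n with hn0 | hn0
      · subst hn0; simp
      · have : (1 : ℝ) ≤ n := by exact_mod_cast hn0
        nlinarith
    exact div_nonneg (by positivity) hnn
  · have hmn : m ≤ n := min_le_right k n
    have hn2 : 2 ≤ n := hm2.trans hmn
    -- union bound over the slots
    have hunion : #((kSubsets n k).filter fun A => ∃ e ∈ F, ∀ v ∈ (e : Sym2 (Fin n)), v ∈ A) ≤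
        #F * (n - 2).choose (m - 2) := by
      calc #((kSubsets n k).filter fun A => ∃ e ∈ F, ∀ v ∈ (e : Sym2 (Fin n)), v ∈ A)
          ≤ #(F.biUnion fun e => (kSubsets n k).filter fun A => ∀ v ∈ (e : Sym2 (Fin n)), v ∈ A) := by
            refine card_le_card fun A hA => ?_
            rw [mem_filter] at hA
            obtain ⟨e, heF, he⟩ := hA.2
            exact mem_biUnion.2 ⟨e, heF, mem_filter.2 ⟨hA.1, he⟩⟩
        _ ≤ ∑ e ∈ F, #((kSubsets n k).filter fun A => ∀ v ∈ (e : Sym2 (Fin n)), v ∈ A) := card_biUnion_le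
        _ ≤ ∑ _e ∈ F, (n - 2).choose (m - 2) := by
            refine sum_le_sum fun e _ => ?_
            obtain ⟨⟨u, v⟩, huv⟩ := Quot.exists_rep (e : Sym2 (Fin n))
            have hadj : (⊤ : SimpleGraph (Fin n)).Adj u v := by
              rw [← SimpleGraph.mem_edgeSet, show s(u, v) = (e : Sym2 (Fin n)) from huv]; exact e.2
            have hne : u ≠ v := hadj.ne
            have heq : ((kSubsets n k).filter fun A => ∀ w ∈ (e : Sym2 (Fin n)), w ∈ A) =
                ((powersetCard m (univ : Finset (Fin n))).filter fun A => u ∈ A ∧ v ∈ A) := by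
              rw [kSubsets, ← hm]
              refine filter_congr fun A _ => ?_
              rw [← huv]
              change (∀ w ∈ s(u, v), w ∈ A) ↔ u ∈ A ∧ v ∈ A
              simp [Sym2.mem_iff]
            rw [heq]
            have h := card_powersetCard_pair_le (univ : Finset (Fin n)) hne (mem_univ u) (mem_univ v) m
            rwa [card_univ, Fintype.card_fin] at h
        _ = #F * (n - 2).choose (m - 2) := by rw [sum_const, smul_eq_mul]
    have hratio := choose_sub_two_mul hm2 hmn
    have hn1 : (0 : ℝ) < (n : ℝ) * ((n : ℝ) - 1) := by
      have : (2 : ℝ) ≤ n := by exact_mod_cast hn2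
      nlinarith
    rw [div_le_div_iff₀ h𝒜pos hn1, h𝒜]
    have hR : (((n - 2).choose (m - 2) : ℕ) : ℝ) * ((n : ℝ) * ((n : ℝ) - 1)) =
        ((n.choose m : ℕ) : ℝ) * ((m : ℝ) * ((m : ℝ) - 1)) := by
      have := congrArg (fun t : ℕ => (t : ℝ)) hratio
      push_cast [Nat.cast_sub (by omega : 1 ≤ n), Nat.cast_sub (by omega : 1 ≤ m)] at this
      exact this
    have hm1 : (m : ℝ) * ((m : ℝ) - 1) ≤ (m : ℝ) ^ 2 := by nlinarith
    calc (#((kSubsets n k).filter fun A => ∃ e ∈ F, ∀ v ∈ (e : Sym2 (Fin n)), v ∈ A) : ℝ) * ((n : ℝ) * ((n : ℝ) - 1))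
        ≤ ((#F : ℝ) * (((n - 2).choose (m - 2) : ℕ) : ℝ)) * ((n : ℝ) * ((n : ℝ) - 1)) := by
          refine mul_le_mul_of_nonneg_right ?_ hn1.le
          exact_mod_cast hunion
      _ = (#F : ℝ) * (((n.choose m : ℕ) : ℝ) * ((m : ℝ) * ((m : ℝ) - 1))) := by rw [mul_assoc, hR]
      _ ≤ (#F : ℝ) * (((n.choose m : ℕ) : ℝ) * (m : ℝ) ^ 2) := by
          refine mul_le_mul_of_nonneg_left (mul_le_mul_of_nonneg_left hm1 (by positivity)) (by positivity)
      _ = (#F : ℝ) * ((m : ℕ) : ℝ) ^ 2 * ((n.choose m : ℕ) : ℝ) := by ring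

/-! ### The averaging step -/

/-- **Per-`n` pinning step (Adleman over the pinned values).** For every test `f` on the edge vectors
of `Kₙ` and every block `F` of slots, SOME pinning `w` of the block has
`Pr₀[f ∘ merge w = 1] + Pr₁[f ∘ merge w = 0] ≤ Pr₀[f = 1] + Pr₁[f = 0] + #{A : K_A meets F}/#kSubsets`.
[folklore] -/
theorem pinning_step {n k : ℕ} (f : EdgeVec n → Bool) (F : Finset ((⊤ : SimpleGraph (Fin n)).edgeSet)) :
    ∃ w : EdgeVec n,
      ((erdosRenyiHalf n).toOuterMeasure {x | f (fun e => if e ∈ F then w e else x e) = true}).toReal +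
        ((plantedCliqueDist n k).toOuterMeasure {x | f (fun e => if e ∈ F then w e else x e) = false}).toReal ≤
      ((erdosRenyiHalf n).toOuterMeasure {x | f x = true}).toReal +
        ((plantedCliqueDist n k).toOuterMeasure {x | f x = false}).toReal +
        (#((kSubsets n k).filter fun A => ∃ e ∈ F, ∀ v ∈ (e : Sym2 (Fin n)), v ∈ A) : ℝ) / #(kSubsets n k) := by
  classical
  have hcard : Fintype.card ((⊤ : SimpleGraph (Fin n)).edgeSet) = n.choose 2 := card_edgeSet_top_fin n
  set N := n.choose 2 with hN
  set κ := (min k n).choose 2 with hκdef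
  have hκ : ∀ A ∈ kSubsets n k, #(univ.filter fun e : (⊤ : SimpleGraph (Fin n)).edgeSet =>
      ∀ v ∈ (e : Sym2 (Fin n)), v ∈ A) = κ := fun A hA => by
    rw [card_cliqueSlots A, card_of_mem_kSubsets hA]
  have h𝒜pos : (0 : ℝ) < #(kSubsets n k) := by exact_mod_cast card_pos.2 (kSubsets_nonempty n k)
  have h2N : (0 : ℝ) < 2 ^ N := by positivity
  have hZ : (0 : ℝ) < (#(kSubsets n k) : ℝ) * 2 ^ (N - κ) := by positivity
  -- the NULL sum over the pinnings: exact
  have hnull : ∑ w : EdgeVec n,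
      ((erdosRenyiHalf n).toOuterMeasure {x | f (fun e => if e ∈ F then w e else x e) = true}).toReal =
      (2 : ℝ) ^ N * ((erdosRenyiHalf n).toOuterMeasure {x | f x = true}).toReal := by
    simp only [toReal_erdosRenyiHalf_eq]
    rw [← sum_div, sum_card_merge_eq F f, hcard, ← hN]
    ring
  -- the PLANTED sum over the pinnings: exact off the block, bounded on it
  have hplanted : ∑ w : EdgeVec n,
      ((plantedCliqueDist n k).toOuterMeasure {x | f (fun e => if e ∈ F then w e else x e) = false}).toReal ≤
      (2 : ℝ) ^ N * (((plantedCliqueDist n k).toOuterMeasure {x | f x = false}).toReal +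
        (#((kSubsets n k).filter fun A => ∃ e ∈ F, ∀ v ∈ (e : Sym2 (Fin n)), v ∈ A) : ℝ) / #(kSubsets n k)) := by
    simp only [toReal_plantedCliqueDist_eq]
    rw [← sum_div, mul_add, mul_div_assoc', mul_div_assoc']
    rw [div_add_div _ _ hZ.ne' h𝒜pos.ne', div_le_div_iff₀ hZ (mul_pos hZ h𝒜pos)]
    -- fibre over the planted sets and swap the sums
    simp only [card_filter_product_eq_sum]
    rw [sum_comm]
    -- per planted set: exact if it misses the block, trivial bound if it meets it
    have hA : ∀ A ∈ kSubsets n k, ∑ w : EdgeVec n, (#((univ : Finset (EdgeVec n)).filter fun x =>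
        (univ.filter fun e : (⊤ : SimpleGraph (Fin n)).edgeSet => ∀ v ∈ (e : Sym2 (Fin n)), v ∈ A) ⊆
          (univ.filter fun e => x e = true) ∧ f (fun e => if e ∈ F then w e else x e) = false) : ℝ) ≤
        (2 : ℝ) ^ N * #((univ : Finset (EdgeVec n)).filter fun y =>
          (univ.filter fun e : (⊤ : SimpleGraph (Fin n)).edgeSet => ∀ v ∈ (e : Sym2 (Fin n)), v ∈ A) ⊆
            (univ.filter fun e => y e = true) ∧ f y = false) +
        (if (∃ e ∈ F, ∀ v ∈ (e : Sym2 (Fin n)), v ∈ A) then (2 : ℝ) ^ N * 2 ^ (N - κ) else 0) := by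
      intro A hAmem
      by_cases hmeet : ∃ e ∈ F, ∀ v ∈ (e : Sym2 (Fin n)), v ∈ A
      · rw [if_pos hmeet]
        have h1 := sum_card_merge_supset_le F
          (univ.filter fun e : (⊤ : SimpleGraph (Fin n)).edgeSet => ∀ v ∈ (e : Sym2 (Fin n)), v ∈ A) f
        have h2 := card_supset_mul_two_pow (α := (⊤ : SimpleGraph (Fin n)).edgeSet)
          (univ.filter fun e : (⊤ : SimpleGraph (Fin n)).edgeSet => ∀ v ∈ (e : Sym2 (Fin n)), v ∈ A)
        rw [hκ A hAmem, hcard] at h2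
        rw [hcard] at h1
        have h3 : (#((univ : Finset (EdgeVec n)).filter fun y =>
            (univ.filter fun e : (⊤ : SimpleGraph (Fin n)).edgeSet => ∀ v ∈ (e : Sym2 (Fin n)), v ∈ A) ⊆
              univ.filter fun e => y e = true) : ℝ) = 2 ^ (N - κ) := by
          have hκN : κ ≤ N := by
            rw [hκdef, hN]; exact Nat.choose_le_choose 2 (min_le_right k n)
          have : (2 : ℝ) ^ N = 2 ^ (N - κ) * 2 ^ κ := by rw [← pow_add, Nat.sub_add_cancel hκN]
          rw [this] at h2
          exact mul_right_cancel₀ (pow_ne_zero κ two_ne_zero) h2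
        rw [h3] at h1
        refine h1.trans ?_
        have : (0 : ℝ) ≤ (2 : ℝ) ^ N * #((univ : Finset (EdgeVec n)).filter fun y =>
            (univ.filter fun e : (⊤ : SimpleGraph (Fin n)).edgeSet => ∀ v ∈ (e : Sym2 (Fin n)), v ∈ A) ⊆
              (univ.filter fun e => y e = true) ∧ f y = false) := by positivity
        linarith
      · rw [if_neg hmeet, add_zero]
        have hdisj : Disjoint (univ.filter fun e : (⊤ : SimpleGraph (Fin n)).edgeSet =>
            ∀ v ∈ (e : Sym2 (Fin n)), v ∈ A) F := by
          rw [disjoint_left]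
          intro e he heF
          exact hmeet ⟨e, heF, (mem_filter.1 he).2⟩
        have h1 := sum_card_merge_supset_eq F _ hdisj f
        rw [hcard] at h1
        exact h1.le
    calc (∑ A ∈ kSubsets n k, ∑ w : EdgeVec n, (#((univ : Finset (EdgeVec n)).filter fun x =>
          (univ.filter fun e : (⊤ : SimpleGraph (Fin n)).edgeSet => ∀ v ∈ (e : Sym2 (Fin n)), v ∈ A) ⊆
            (univ.filter fun e => x e = true) ∧ f (fun e => if e ∈ F then w e else x e) = false) : ℝ)) *
          ((#(kSubsets n k) : ℝ) * 2 ^ (N - κ) * #(kSubsets n k))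
        ≤ (∑ A ∈ kSubsets n k, ((2 : ℝ) ^ N * #((univ : Finset (EdgeVec n)).filter fun y =>
            (univ.filter fun e : (⊤ : SimpleGraph (Fin n)).edgeSet => ∀ v ∈ (e : Sym2 (Fin n)), v ∈ A) ⊆
              (univ.filter fun e => y e = true) ∧ f y = false) +
            (if (∃ e ∈ F, ∀ v ∈ (e : Sym2 (Fin n)), v ∈ A) then (2 : ℝ) ^ N * 2 ^ (N - κ) else 0))) *
          ((#(kSubsets n k) : ℝ) * 2 ^ (N - κ) * #(kSubsets n k)) :=
          mul_le_mul_of_nonneg_right (sum_le_sum hA) (by positivity)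
      _ = _ := by
          rw [sum_add_distrib, ← mul_sum, sum_ite, sum_const_zero, add_zero, sum_const, nsmul_eq_mul]
          ring
  -- ADLEMAN over the pinnings
  have hne : (univ : Finset (EdgeVec n)).Nonempty := univ_nonempty
  have hcardW : (#(univ : Finset (EdgeVec n)) : ℝ) = (2 : ℝ) ^ N := by
    rw [card_univ, Fintype.card_fun, Fintype.card_bool, hcard]
    push_cast
    ring
  have hsum : ∑ w : EdgeVec n,
      (((erdosRenyiHalf n).toOuterMeasure {x | f (fun e => if e ∈ F then w e else x e) = true}).toReal +
        ((plantedCliqueDist n k).toOuterMeasure {x | f (fun e => if e ∈ F then w e else x e) = false}).toReal) ≤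
      ∑ _w : EdgeVec n, (((erdosRenyiHalf n).toOuterMeasure {x | f x = true}).toReal +
        ((plantedCliqueDist n k).toOuterMeasure {x | f x = false}).toReal +
        (#((kSubsets n k).filter fun A => ∃ e ∈ F, ∀ v ∈ (e : Sym2 (Fin n)), v ∈ A) : ℝ) / #(kSubsets n k)) := by
    rw [sum_add_distrib, sum_const, nsmul_eq_mul, hcardW, hnull]
    linarith [hplanted]
  obtain ⟨w, -, hw⟩ := exists_le_of_sum_le hne hsum
  exact ⟨w, hw⟩

/-! ### Hard-wiring the block and the wires -/

/-- **Pinning is free**: hard-wiring the inputs of a block `F` to constants `w` and the extra wires to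
constants `c` in a `{∧₂,∨₂,0,1}`-circuit costs the two constant gates. [folklore] -/
theorem exists_pin_circuit {ι κ : Type*} [DecidableEq ι] (D : Circuit (ι ⊕ κ)) (hD : D.IsOver monotoneBasis01)
    (F : Finset ι) (w : ι → Bool) (c : κ → Bool) :
    ∃ C : Circuit ι, C.IsOver monotoneBasis01 ∧ C.size ≤ D.size + 2 ∧
      ∀ x, C.eval x = D.eval (Sum.elim (fun i => if i ∈ F then w i else x i) c) := by
  have h1 : CktSize monotoneBasis01 (fun (x : ι → Bool) => Sum.elim x (fun b : Bool => b)) (0 + 2) :=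
    (CktSize.id monotoneBasis01).pair (cktSize_consts_mono01 ι)
  let ρ : ι ⊕ κ → ι ⊕ Bool := Sum.elim (fun i => if i ∈ F then Sum.inr (w i) else Sum.inl i) (fun j => Sum.inr (c j))
  have h2 : CktSize monotoneBasis01
      (fun (x : ι → Bool) => Sum.elim (fun i => if i ∈ F then w i else x i) c) (0 + 2) :=
    (h1.outMap ρ).congr fun x o => by
      rcases o with i | j
      · by_cases hi : i ∈ F <;> simp [ρ, hi]
      · simp [ρ]
  have h3 := h2.comp (D.cktSize_eval hD)
  obtain ⟨C, hC, hsize, hev⟩ := h3.toCircuit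
  exact ⟨C, hC, by omega, fun x => hev x⟩

/-! ### The rung -/

/-- A finite error sum is the `ofReal` of the sum of the two real probabilities. [folklore] -/
theorem errSum_eq_ofReal {n k : ℕ} (S T : Set (EdgeVec n)) :
    (erdosRenyiHalf n).toOuterMeasure S + (plantedCliqueDist n k).toOuterMeasure T =
      ENNReal.ofReal (((erdosRenyiHalf n).toOuterMeasure S).toReal +
        ((plantedCliqueDist n k).toOuterMeasure T).toReal) := by
  have h0 : (erdosRenyiHalf n).toOuterMeasure S ≠ ⊤ :=
    ne_top_of_le_ne_top ENNReal.one_ne_top (((erdosRenyiHalf n).toOuterMeasure.mono (Set.subset_univ _)).trans_eq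
      ((PMF.toOuterMeasure_apply_eq_one_iff _ _).2 (Set.subset_univ _)))
  have h1 : (plantedCliqueDist n k).toOuterMeasure T ≠ ⊤ :=
    ne_top_of_le_ne_top ENNReal.one_ne_top (((plantedCliqueDist n k).toOuterMeasure.mono (Set.subset_univ _)).trans_eq
      ((PMF.toOuterMeasure_apply_eq_one_iff _ _).2 (Set.subset_univ _)))
  rw [ENNReal.ofReal_add ENNReal.toReal_nonneg ENNReal.toReal_nonneg, ENNReal.ofReal_toReal h0,
    ENNReal.ofReal_toReal h1]

/-- **blockPinning** (registered helper sub-goal of stmt-PneNP-18026): wires computing ARBITRARY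
functions of a clique-sparse block of edge slots are free — pin the block. See the module docstring.
[folklore] -/
theorem blockPinning :
    ∀ (k s : ℕ → ℕ) (κ : ℕ → Type) (F : (n : ℕ) → Finset ((⊤ : SimpleGraph (Fin n)).edgeSet)) (D : (n : ℕ) → Circuit ((⊤ : SimpleGraph (Fin n)).edgeSet ⊕ κ n)) (a : (n : ℕ) → EdgeVec n → κ n → Bool), (∀ (n : ℕ) (x x' : EdgeVec n), (∀ e ∈ F n, x e = x' e) → a n x = a n x') → (∀ᶠ n : ℕ in atTop, (D n).IsOver monotoneBasis01 ∧ (D n).size ≤ s n) → Tendsto (fun n : ℕ => (erdosRenyiHalf n).toOuterMeasure {x | (D n).eval (Sum.elim x (a n x)) = true} + (plantedCliqueDist n (k n)).toOuterMeasure {x | (D n).eval (Sum.elim x (a n x)) = false}) atTop (nhds 0) → Tendsto (fun n : ℕ => (#(F n) : ℝ) * (k n : ℝ) ^ 2 / (n : ℝ) ^ 2) atTop (nhds 0) → ∃ M : (n : ℕ) → Circuit ((⊤ : SimpleGraph (Fin n)).edgeSet), (∀ᶠ n : ℕ in atTop, (M n).IsOver monotoneBasis01 ∧ (M n).size ≤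 s n + 2) ∧ Tendsto (fun n : ℕ => (erdosRenyiHalf n).toOuterMeasure {x | (M n).eval x = true} + (plantedCliqueDist n (k n)).toOuterMeasure {x | (M n).eval x = false}) atTop (nhds 0) := by
  intro k s κ F D a ha hD herr hF
  classical
  -- pointwise in `n`: pin the block at a good `w`
  have hex : ∀ n : ℕ, (D n).IsOver monotoneBasis01 →
      ∃ M : Circuit ((⊤ : SimpleGraph (Fin n)).edgeSet), M.IsOver monotoneBasis01 ∧ M.size ≤ (D n).size + 2 ∧
        ((erdosRenyiHalf n).toOuterMeasure {x | M.eval x = true}).toReal +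
            ((plantedCliqueDist n (k n)).toOuterMeasure {x | M.eval x = false}).toReal ≤
          ((erdosRenyiHalf n).toOuterMeasure {x | (D n).eval (Sum.elim x (a n x)) = true}).toReal +
            ((plantedCliqueDist n (k n)).toOuterMeasure {x | (D n).eval (Sum.elim x (a n x)) = false}).toReal +
            (#(F n) : ℝ) * ((min (k n) n : ℕ) : ℝ) ^ 2 / ((n : ℝ) * ((n : ℝ) - 1)) := by
    intro n hDn
    obtain ⟨w, hw⟩ := pinning_step (k := k n) (fun x => (D n).eval (Sum.elim x (a n x))) (F n)
    obtain ⟨M, hM, hsize, hev⟩ := exists_pin_circuit (D n) hDn (F n) w (a n w)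
    refine ⟨M, hM, hsize, ?_⟩
    -- the pinned circuit computes `f ∘ merge w` (the wires see only the block, which is `w` there)
    have hmerge : ∀ x : EdgeVec n, M.eval x =
        (D n).eval (Sum.elim (fun e => if e ∈ F n then w e else x e) (a n (fun e => if e ∈ F n then w e else x e))) := by
      intro x
      rw [hev x, ha n w (fun e => if e ∈ F n then w e else x e) (fun e he => by simp [he])]
    have e1 : {x | M.eval x = true} =
        {x | (D n).eval (Sum.elim (fun e => if e ∈ F n then w e else x e) (a n (fun e => if e ∈ F n then w e else x e))) = true} := by
      ext x; rw [Set.mem_setOf_eq, Set.mem_setOf_eq, hmerge x]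
    have e2 : {x | M.eval x = false} =
        {x | (D n).eval (Sum.elim (fun e => if e ∈ F n then w e else x e) (a n (fun e => if e ∈ F n then w e else x e))) = false} := by
      ext x; rw [Set.mem_setOf_eq, Set.mem_setOf_eq, hmerge x]
    rw [e1, e2]
    exact hw.trans (add_le_add le_rfl (card_meet_div_le n (k n) (F n)))
  let M : (n : ℕ) → Circuit ((⊤ : SimpleGraph (Fin n)).edgeSet) := fun n =>
    if h : (D n).IsOver monotoneBasis01 then (hex n h).choose else Circuit.const _ false
  refine ⟨M, ?_, ?_⟩
  · filter_upwards [hD] with n hn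
    have hMn : M n = (hex n hn.1).choose := dif_pos hn.1
    obtain ⟨hB, hsize, -⟩ := (hex n hn.1).choose_spec
    rw [hMn]
    exact ⟨hB, hsize.trans (Nat.add_le_add_right hn.2 2)⟩
  · -- the real error sums tend to `0`
    obtain ⟨hPI, hPII⟩ := tendsto_toReal_of_add_tendsto_zero herr
    have hρ : Tendsto (fun n : ℕ => (#(F n) : ℝ) * ((min (k n) n : ℕ) : ℝ) ^ 2 / ((n : ℝ) * ((n : ℝ) - 1)))
        atTop (nhds 0) := by
      -- `#F · m² / (n(n-1)) ≤ 2 · (#F · k² / n²)` for `n ≥ 2`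
      have h2 := hF.const_mul 2
      rw [mul_zero] at h2
      refine tendsto_of_tendsto_of_tendsto_of_le_of_le' tendsto_const_nhds h2 ?_ ?_
      · filter_upwards [eventually_ge_atTop 2] with n hn
        have : (2 : ℝ) ≤ n := by exact_mod_cast hn
        have hden : (0 : ℝ) < (n : ℝ) * ((n : ℝ) - 1) := by nlinarith
        positivity
      · filter_upwards [eventually_ge_atTop 2] with n hn
        have hn2 : (2 : ℝ) ≤ n := by exact_mod_cast hn
        have hden : (0 : ℝ) < (n : ℝ) * ((n : ℝ) - 1) := by nlinarith
        have hn0 : (0 : ℝ) < (n : ℝ) ^ 2 := by positivity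
        have hmk : ((min (k n) n : ℕ) : ℝ) ≤ (k n : ℝ) := by exact_mod_cast min_le_left (k n) n
        rw [div_le_iff₀ hden]
        calc (#(F n) : ℝ) * ((min (k n) n : ℕ) : ℝ) ^ 2 ≤ (#(F n) : ℝ) * (k n : ℝ) ^ 2 := by
              refine mul_le_mul_of_nonneg_left (pow_le_pow_left₀ (by positivity) hmk 2) (by positivity)
          _ = ((#(F n) : ℝ) * (k n : ℝ) ^ 2 / (n : ℝ) ^ 2) * (n : ℝ) ^ 2 := by field_simp
          _ ≤ ((#(F n) : ℝ) * (k n : ℝ) ^ 2 / (n : ℝ) ^ 2) * (2 * ((n : ℝ) * ((n : ℝ) - 1))) := by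
              refine mul_le_mul_of_nonneg_left (by nlinarith) (by positivity)
          _ = 2 * ((#(F n) : ℝ) * (k n : ℝ) ^ 2 / (n : ℝ) ^ 2) * ((n : ℝ) * ((n : ℝ) - 1)) := by ring
    have hlim : Tendsto (fun n : ℕ => ENNReal.ofReal
        (((erdosRenyiHalf n).toOuterMeasure {x | (D n).eval (Sum.elim x (a n x)) = true}).toReal +
          ((plantedCliqueDist n (k n)).toOuterMeasure {x | (D n).eval (Sum.elim x (a n x)) = false}).toReal +
          (#(F n) : ℝ) * ((min (k n) n : ℕ) : ℝ) ^ 2 / ((n : ℝ) * ((n : ℝ) - 1)))) atTop (nhds 0) := by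
      have h := (hPI.add hPII).add hρ
      simp only [add_zero] at h
      rw [← ENNReal.ofReal_zero]
      exact ENNReal.tendsto_ofReal h
    refine tendsto_of_tendsto_of_tendsto_of_le_of_le' tendsto_const_nhds hlim
      (Eventually.of_forall fun n => bot_le) ?_
    filter_upwards [hD] with n hn
    have hMn : M n = (hex n hn.1).choose := dif_pos hn.1
    obtain ⟨-, -, hbound⟩ := (hex n hn.1).choose_spec
    rw [hMn, errSum_eq_ofReal]
    exact ENNReal.ofReal_le_ofReal hbound

end Summit.PneNP.PneNP.Theorems.MonotoneSuffices.BlockPinning
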